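import Literature.IUT.HodgeArakelov.LabelClassesOfCuspsR

/-!
# [IUTchII] Cor 2.4 (ii)/(iii): the decomposition group `D^δ_t := N_{Π^δ_v}(I^δ_t)` is compatible with conjugation — PROVED

S. Mochizuki, *Inter-universal Teichmüller theory II*, kurims manuscript (Dec. 2020), §2, Corollary 2.4 (ii), (iii),
p. 70 ([IUTchII] Cor 2.4 (ii)(iii), kurims p.70) [claim: Mochizuki2012, status: disputed] (D-0012 claim key; series status
DISPUTED).  PROOF-ONLY companion (abc-iut cell, D-0067 cone discharge wave 4, seat abc-iut-w4-d012; nodes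
`IUTchII:Cor2.4(ii)`, `IUTchII:Cor2.4(iii)`) of `LabelClassesOfCusps.lean` (abc-iut-L6-t1, p407174: `TwoTorsionTranslates`,
`TwoTorsionTranslates.Dt`) and of the repair file `LabelClassesOfCuspsR.lean` (abc-iut-L6-d1, p408486:
`PlusMinusTower.cuspDecomp`, `Cor24_ii_iii'`, `cor24_ii_iii'_iff`).  No new definitions; landed modules untouched.

PRINT (p. 70).  (ii): "… any inclusion `I^δ_t ⊆ Π^δ_{v□}` as in (i) completely determines the following data: (a) a
decomposition group `D^δ_t := N_{Π^δ_v}(I^δ_t) ⊆ Π^δ_{v□̈}` …; (b) … `D^δ_{μ_-}` …; (c) … `D^δ_{t,μ_-}` … Moreover, the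
construction of the above data is compatible with conjugation by arbitrary `δ ∈ Δ̂^±_v`, as well as with the natural
inclusion `Π_{v•t} ⊆ Π_{v▶}` of Definition 2.3, (iv), as one varies `□ ∈ {•t, ▶}`."  (iii) "(`𝔽_l^{⋊±}`-Symmetry) Suppose
that `□ = •t`. Then the construction of the data of (ii), (a), (c), is compatible with conjugation by arbitrary
`δ ∈ Π̂^cor_v` [cf. Remark 2.3.1]."  Printed proof (p. 71): "Assertions (ii) and (iii) follow immediately from the
definitions and the references quoted in the statements of these assertions."

In the tree, datum (a) is DEFINED (`TwoTorsionTranslates.Dt` = `PlusMinusTower.cuspDecomp I δ`, the normaliser of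
`I^δ` in `Π^δ_v`, inside `Π̂^cor_v`), while (b), (c) are carried as bare data (their defining property, [SemiAnbd] Thm. 6.8
(iii), is not in the tree; `cor24_ii_iii'_iff` records that the repaired predicate `Cor24_ii_iii'` therefore has exactly
the content of clause (a) "`D^δ_t ⊆ Π^δ_{v□̈}`").  For datum (a) the two compatibility clauses are THEOREMS of group
theory, proved here for every tower and EVERY `ε ∈ Π̂^cor_v` (so for `Δ̂^±_v` in (ii) and `Π̂^cor_v` in (iii) alike):

* `PlusMinusTower.mem_cuspDecomp_iff` — membership in `D^δ_t`: `x ∈ Π^δ_v` normalising `I^δ` (relative to `Π^δ_v`);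
* `PlusMinusTower.cuspDecomp_mul` — **(ii)/(iii) compatibility with conjugation**: `D^{ε·δ}_t = (D^δ_t)^ε`;
  `cuspDecomp_eq_map_one` — `D^δ_t = (D^1_t)^δ`;
* `TwoTorsionTranslates.dt_mul` / `dt_indep` — the same for the data packages of the landed structure, and
  **(ii) compatibility with `Π_{v•t} ⊆ Π_{v▶}`**: datum (a) does not depend on `□` at all;
* `cor24_ii_iii'_iff_one` — consequently the repaired predicate `Cor24_ii_iii' W C H` (all `δ ∈ Π̂^cor_v`) is
  EQUIVALENT to its instance at `δ = 1`: "`N_{Π_v}(I_t) ⊆ Π_{v□̈}` for every cuspidal inertia group `I_t ⊆ Δ_{v□}`"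
  — the one remaining (anabelian) clause, whose input ([SemiAnbd] Thm. 6.8 (iii) / Cor. 3.11, [IUTchI] Ex. 4.4 (i))
  is L3/L5 merge debt and is NOT proved here.

Abstract core (any group `G`, subgroups `A, B`, `ε ∈ G`): `mem_relNormalizer_iff`, `relNormalizer_map_conj` — the
normaliser of `A` relative to `B`, `N_B(A) := {x ∈ B | ∀ h ∈ B, h ∈ A ↔ xhx⁻¹ ∈ A}`, satisfies `N_{B^ε}(A^ε) = N_B(A)^ε`.
Nothing here takes a side on [IUTchIII] Cor. 3.12; typed ≠ discharged for clause (a)'s inclusion itself.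
-/

namespace Literature.IUT.HodgeArakelov

universe u

/-! ### Relative normalisers and conjugation (plain group theory) -/

section RelNormalizer

variable {G : Type u} [Group G]

/-- `(ε·δ)·K·(ε·δ)⁻¹ = ε·(δ·K·δ⁻¹)·ε⁻¹` on subgroups. [folklore] -/
private theorem map_conj_mul_eq_map_map' (K : Subgroup G) (ε δ : G) :
    K.map (MulAut.conj (ε * δ)).toMonoidHom =
      (K.map (MulAut.conj δ).toMonoidHom).map (MulAut.conj ε).toMonoidHom := by
  ext x
  rw [Subgroup.mem_map_equiv, Subgroup.mem_map_equiv, Subgroup.mem_map_equiv, MulAut.conj_symm_apply,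
    MulAut.conj_symm_apply, MulAut.conj_symm_apply, mul_inv_rev]
  constructor <;> intro h <;> simpa [mul_assoc] using h

/-- `y ∈ εKε⁻¹ ↔ ε⁻¹yε ∈ K`. [folklore] -/
private theorem mem_map_conj_iff' (K : Subgroup G) (ε y : G) :
    y ∈ K.map (MulAut.conj ε).toMonoidHom ↔ ε⁻¹ * y * ε ∈ K := by
  rw [Subgroup.mem_map_equiv, MulAut.conj_symm_apply]

/-- Conjugation by `1` is the identity on subgroups. [folklore] -/
private theorem map_conj_one (K : Subgroup G) : K.map (MulAut.conj (1 : G)).toMonoidHom = K := by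
  ext y
  rw [mem_map_conj_iff', inv_one, one_mul, mul_one]

/-- Membership in the RELATIVE normaliser `N_B(A)` (the normaliser of `A ∩ B` computed inside `B`, viewed in `G` — the
shape of "`D^δ_t := N_{Π^δ_v}(I^δ_t)`", [IUTchII] Cor. 2.4 (ii)(a) p. 70, and of `Π^±_{v□} := N_{Π^±_v}(Π_{v□})`, Def. 2.3
(i) p. 67): `x ∈ B` and, for `h ∈ B`, `h ∈ A ↔ xhx⁻¹ ∈ A`. ([IUTchII] Cor 2.4 (ii) p.70)
[claim: Mochizuki2012, status: disputed] -/
theorem mem_relNormalizer_iff (A B : Subgroup G) (x : G) :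
    x ∈ (Subgroup.normalizer ((A.subgroupOf B : Subgroup B) : Set B)).map B.subtype ↔
      x ∈ B ∧ ∀ h : G, h ∈ B → (h ∈ A ↔ x * h * x⁻¹ ∈ A) := by
  constructor
  · rintro ⟨y, hy, rfl⟩
    rw [SetLike.mem_coe, Subgroup.mem_normalizer_iff] at hy
    refine ⟨y.2, fun h hh => ?_⟩
    simpa [Subgroup.mem_subgroupOf] using hy ⟨h, hh⟩
  · rintro ⟨hx, hn⟩
    refine ⟨⟨x, hx⟩, ?_, rfl⟩
    rw [SetLike.mem_coe, Subgroup.mem_normalizer_iff]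
    intro h
    simpa [Subgroup.mem_subgroupOf] using hn h h.2

/-- **Relative normalisers commute with conjugation**: `N_{εBε⁻¹}(εAε⁻¹) = ε·N_B(A)·ε⁻¹` — the group theory behind
"the construction of [`D^δ_t := N_{Π^δ_v}(I^δ_t)`] is compatible with conjugation by arbitrary `δ`" ([IUTchII]
Cor. 2.4 (ii), (iii), p. 70). ([IUTchII] Cor 2.4 (iii) p.70) [claim: Mochizuki2012, status: disputed] -/
theorem relNormalizer_map_conj (A B : Subgroup G) (ε : G) :
    (Subgroup.normalizer ((((A.map (MulAut.conj ε).toMonoidHom).subgroupOf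
        (B.map (MulAut.conj ε).toMonoidHom) : Subgroup (B.map (MulAut.conj ε).toMonoidHom)) :
          Set (B.map (MulAut.conj ε).toMonoidHom)))).map (B.map (MulAut.conj ε).toMonoidHom).subtype =
      ((Subgroup.normalizer ((A.subgroupOf B : Subgroup B) : Set B)).map B.subtype).map
        (MulAut.conj ε).toMonoidHom := by
  ext x
  rw [mem_relNormalizer_iff, mem_map_conj_iff' ((Subgroup.normalizer ((A.subgroupOf B : Subgroup B) : Set B)).map
      B.subtype) ε x, mem_relNormalizer_iff, mem_map_conj_iff' B ε x]
  refine and_congr_right fun _ => ⟨fun hn h' hh' => ?_, fun hn h hh => ?_⟩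
  · -- from the conjugated side to the original side: test element `h := ε h' ε⁻¹`
    have hmem : ε * h' * ε⁻¹ ∈ B.map (MulAut.conj ε).toMonoidHom := by
      rw [mem_map_conj_iff']
      have : ε⁻¹ * (ε * h' * ε⁻¹) * ε = h' := by group
      rwa [this]
    have key := hn _ hmem
    rw [mem_map_conj_iff', mem_map_conj_iff'] at key
    have e1 : ε⁻¹ * (ε * h' * ε⁻¹) * ε = h' := by group
    have e2 : ε⁻¹ * (x * (ε * h' * ε⁻¹) * x⁻¹) * ε = ε⁻¹ * x * ε * h' * (ε⁻¹ * x * ε)⁻¹ := by group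
    rwa [e1, e2] at key
  · -- from the original side to the conjugated side: test element `h' := ε⁻¹ h ε`
    have hmem : ε⁻¹ * h * ε ∈ B := (mem_map_conj_iff' B ε h).mp hh
    have key := hn _ hmem
    rw [mem_map_conj_iff', mem_map_conj_iff']
    have e2 : ε⁻¹ * x * ε * (ε⁻¹ * h * ε) * (ε⁻¹ * x * ε)⁻¹ = ε⁻¹ * (x * h * x⁻¹) * ε := by group
    rwa [e2] at key

end RelNormalizer

/-! ### `D^δ_t := N_{Π^δ_v}(I^δ_t)`: membership and compatibility with conjugation -/

namespace PlusMinusTower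

variable {S : BadPlaceSetting.{u}} {P : TopGroup.{u}} {T : TemperedCoverings S P} (W : PlusMinusTower T)

/-- **IUTchII:Cor2.4(ii)** (a) (kurims p. 70) `D^δ_t := N_{Π^δ_v}(I^δ_t)`, membership: `x ∈ Π^δ_v` and, for `h ∈ Π^δ_v`,
`h ∈ I^δ ↔ xhx⁻¹ ∈ I^δ`. ([IUTchII] Cor 2.4 (ii) p.70) [claim: Mochizuki2012, status: disputed] -/
theorem mem_cuspDecomp_iff (I : Subgroup W.Corhat) (δ x : W.Corhat) :
    x ∈ W.cuspDecomp I δ ↔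
      x ∈ W.piV.map (MulAut.conj δ).toMonoidHom ∧
        ∀ h : W.Corhat, h ∈ W.piV.map (MulAut.conj δ).toMonoidHom →
          (h ∈ I.map (MulAut.conj δ).toMonoidHom ↔ x * h * x⁻¹ ∈ I.map (MulAut.conj δ).toMonoidHom) :=
  mem_relNormalizer_iff _ _ x

/-- **IUTchII:Cor2.4(ii)/(iii)** (kurims p. 70) "the construction of [datum (a), `D^δ_t := N_{Π^δ_v}(I^δ_t)`] is
compatible with conjugation by arbitrary `δ ∈ Δ̂^±_v`" (ii) "… by arbitrary `δ ∈ Π̂^cor_v`" (iii): for EVERY `ε` of the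
ambient `Π̂^cor_v`, `D^{ε·δ}_t = (D^δ_t)^ε`.  PROVED (group theory: relative normalisers commute with conjugation).
([IUTchII] Cor 2.4 (iii) p.70) [claim: Mochizuki2012, status: disputed] -/
theorem cuspDecomp_mul (I : Subgroup W.Corhat) (ε δ : W.Corhat) :
    W.cuspDecomp I (ε * δ) = (W.cuspDecomp I δ).map (MulAut.conj ε).toMonoidHom := by
  unfold cuspDecomp
  rw [map_conj_mul_eq_map_map' I ε δ, map_conj_mul_eq_map_map' W.piV ε δ]
  exact relNormalizer_map_conj _ _ ε

/-- **IUTchII:Cor2.4(ii)/(iii)** (kurims p. 70), the same at the base point: `D^δ_t = (D_t)^δ` with `D_t := N_{Π_v}(I_t)`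
(`δ = 1`). ([IUTchII] Cor 2.4 (iii) p.70) [claim: Mochizuki2012, status: disputed] -/
theorem cuspDecomp_eq_map_one (I : Subgroup W.Corhat) (δ : W.Corhat) :
    W.cuspDecomp I δ = (W.cuspDecomp I 1).map (MulAut.conj δ).toMonoidHom := by
  rw [← cuspDecomp_mul, mul_one]

end PlusMinusTower

/-! ### The data packages of the landed structure `TwoTorsionTranslates` -/

section Packages

variable {S : BadPlaceSetting.{u}} {P : TopGroup.{u}} {T : TemperedCoverings S P} {W : PlusMinusTower T}

/-- **IUTchII:Cor2.4(iii)** (kurims p. 70) "the construction of the data of (ii), (a) … is compatible with conjugation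
by arbitrary `δ ∈ Π̂^cor_v`": for data packages at `δ` and at `ε·δ` (over any `□`, `□'`), `D^{ε·δ}_t = (D^δ_t)^ε`.  PROVED.
([IUTchII] Cor 2.4 (iii) p.70) [claim: Mochizuki2012, status: disputed] -/
theorem TwoTorsionTranslates.dt_mul {H H' : Subgroup P} {I : Subgroup W.Corhat} {ε δ : W.Corhat}
    (X : TwoTorsionTranslates W H I δ) (X' : TwoTorsionTranslates W H' I (ε * δ)) :
    X'.Dt = X.Dt.map (MulAut.conj ε).toMonoidHom := by
  rw [X.dt_eq_cuspDecomp, X'.dt_eq_cuspDecomp]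
  exact W.cuspDecomp_mul I ε δ

/-- **IUTchII:Cor2.4(ii)** (kurims p. 70) "… compatible … with the natural inclusion `Π_{v•t} ⊆ Π_{v▶}` of Definition 2.3,
(iv), as one varies `□ ∈ {•t, ▶}`": datum (a) `D^δ_t` of a package over `Π_{v□}` and of a package over `Π_{v□'}`
coincide (it is `N_{Π^δ_v}(I^δ_t)`, independent of `□`).  PROVED. ([IUTchII] Cor 2.4 (ii) p.70)
[claim: Mochizuki2012, status: disputed] -/
theorem TwoTorsionTranslates.dt_indep {H H' : Subgroup P} {I : Subgroup W.Corhat} {δ : W.Corhat}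
    (X : TwoTorsionTranslates W H I δ) (X' : TwoTorsionTranslates W H' I δ) : X.Dt = X'.Dt := by
  rw [X.dt_eq_cuspDecomp, X'.dt_eq_cuspDecomp]

/-- **IUTchII:Cor2.4(ii)(iii)′ reduced to `δ = 1`** (kurims p. 70): by compatibility with conjugation, the repaired
predicate `Cor24_ii_iii' W C H` (abc-iut-L6-d1; all `δ ∈ Π̂^cor_v`) is EQUIVALENT to its base-point clause (a):
"`D_t = N_{Π_v}(I_t) ⊆ Π_{v□̈}` for every cuspidal inertia group `I_t ⊆ Δ_{v□}`" — the single remaining (anabelian)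
content of Cor. 2.4 (ii)(iii) as typed, NOT proved here (input: [SemiAnbd] Thm. 6.8 (iii), Cor. 3.11; [IUTchI] Ex. 4.4
(i) — L3/L5 merge debt).  PROVED (equivalence). ([IUTchII] Cor 2.4 (ii) p.70) [claim: Mochizuki2012, status: disputed] -/
theorem cor24_ii_iii'_iff_one (W : PlusMinusTower T) (C : CuspidalInertiaData W) (H : Subgroup P) :
    Literature.IUT.HodgeArakelov.Cor24_ii_iii' W C H ↔
      ∀ I : Subgroup W.Corhat, C.IsCuspidalInertia W.piV I → I ≤ W.deltaBox H →
        W.cuspDecomp I 1 ≤ W.boxDd H := by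
  rw [cor24_ii_iii'_iff]
  refine forall_congr' fun I => forall_congr' fun _ => forall_congr' fun _ => ⟨fun h => ?_, fun h δ => ?_⟩
  · have h1 := h 1
    rwa [map_conj_one] at h1
  · rw [W.cuspDecomp_eq_map_one I δ]
    exact Subgroup.map_mono h

end Packages

end Literature.IUT.HodgeArakelov
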